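import Literature.MathematicalPhysics.QuantumFieldTheory.Balaban1983to89.Node00.DressedSlotsOfRecord12
import Literature.MathematicalPhysics.QuantumFieldTheory.Balaban1983to89.Node00.TStepFibreMass
import Literature.MathematicalPhysics.QuantumFieldTheory.Balaban1983to89.Node00.RStepFibreMass

/-!
# NODE 00 — THE CLASS-WISE TELESCOPING OF THE (2.18) CLASS WEIGHTS OF A DATUM, FROM THE DISPLAYED PROVISOS: at a Stage-9 tuple whose selector preserves the prefix
# of every massive sequence, under the unity law of the step weights and the (0.3) provisos on the stepped dressed family, the class weights of the one-step extensions
# of a sequence `π` sum to the class weight of `π` — hypothesis (T) of the N20 lineage's tower sockets, reduced BY NAME to standard provisos + the pin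

Cell `pub-ymgap`, YM-PLAN Track A (HUMAN RULING D-0062); author seat `pub-ymgap-dag-n20-d` (g37, the N20 lineage; the dressed objects `dressedSlotsOfDatum₉ ∕ classWeightOfDatum₉` of
`Node00/DressedSlotsOfRecord12` are this lineage's, g2).  Composition of `Node00/TStepFibreMass.sum_fiber_integral_chi_tstepOfRecord` (the 𝐓-half, g37) and
`Node00/RStepFibreMass.sum_filter_integral_chi_mul_rstepSlot` (the 𝐑-half, g37) along the slot recursion `slot_{m+1} = 𝐑_{m+1}(𝐓-step slot_m)` (`texpAOfRecordFrom_succ`).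
[III] = [Balaban1988Convergent]; [IV] = [Balaban1989LargeFieldI].

WHAT IS PROVED.  ★★★ `sum_fiber_classWeightOfDatum₉_succ_eq`: for a Stage-9 tuple `ϑ`, datum `D`, `g₀, os`, run `p`, couplings `g`, level `m < p.K`, source `t` and a level-`m` sequence
`π`: IF (unity) `IsStepUnity` holds for the step weights `wOfRecord₉ ϑ p g m` between the front factors of levels `m, m+1`; (𝐓-side provisos) the dressed piece `χ_m(π)·slot_m(π)` is
integrable, the step weights are jointly measurable and bounded by `1`, the level-`(m+1)` front factors are measurable; (𝐑-side provisos, [IV] (0.3)) the PRE-𝐑 dressed pieces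
`χ_{m+1}(s′)·(𝐓-step slot_m)(s′)` are measurable, non-negative, bounded, and the fibre integrals of the selected targets vanish nowhere; and (pin) the tuple's selector
`ϑ.ppSel p g (m+1)` preserves the prefix of every massive pre-𝐑 sequence (identity: trivially; live selector: `Node00/LiveSelectorMass`), THEN
`Σ_{s′ : s′.init = π} classWeightOfDatum₉ ϑ D g₀ os p g (m+1) t s′ = classWeightOfDatum₉ ϑ D g₀ os p g m t π`.  At the Stage-13 record (`ϑ := θ.toStage9Params`,
`D := datumOfRecord₁₃CoPH …`, `p := runA₁₃ ∕ runB₁₃ …`, `g := histA₁₃ ∕ histB₁₃ …`) this is hypothesis hTA ∕ hTB of `Summit…BlocksFreshTowerFaces` for the given `(K, t, m, π)`.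

HONEST FRAMING.  Every proviso above is a HYPOTHESIS, displayed (the tree's own: `TStepOfRecord.isRT_tstepOfRecord`'s, `RStepSlotOfRecord.integral_densityOfSlice_rstepSlotOfRecord`'s
`Provisos`, the residual pin of `PpSelOfRecord`); none is discharged here; in particular whether the Stage-13 record's selector is prefix-preserving for the DRESSED family is NOT decided.
Nothing of Bałaban's asserted; no estimate; no `Provisos₁₃CoPH` inhabitant claimed; counts UNMOVED (typed 28∕28 · discharged 8∕27); one finite four-torus programme at fixed `ε` —
NOT ℝ⁴ ∕ OS ∕ mass gap ∕ Clay.  No `def`, no `sorry`, no `axiom`, no `instance`, no `notation`.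
-/

noncomputable section

open MeasureTheory
open scoped BigOperators

namespace Literature.MathematicalPhysics.QuantumFieldTheory.Balaban1983to89.Node00

open T4Continuum B14.Eq218Concrete B15RopTotal T4FiniteEpsInhabited
open B15.BasicStep (fibreIntegral)

variable (F : T4Family) (N : ℕ) [NeZero N]

open scoped Classical in
/-- ★★★ **CLASS-WISE TELESCOPING OF THE DRESSED (2.18) CLASS WEIGHTS FROM THE DISPLAYED PROVISOS.**  See the module docstring: unity + 𝐓-side provisos give
`Σ_{s′.init = π} ∫ χ_{m+1}(s′)·(𝐓-step slot_m)(s′) = ∫ χ_m(π)·slot_m(π)` (`TStepFibreMass`), the (0.3) provisos + a prefix-preserving selector give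
`Σ_{s′.init = π} ∫ χ_{m+1}(s′)·(𝐑(𝐓-step slot_m))(s′) = Σ_{s′.init = π} ∫ χ_{m+1}(s′)·(𝐓-step slot_m)(s′)` (`RStepFibreMass`), and `slot_{m+1} = 𝐑_{m+1}(𝐓-step slot_m)` is the recursion
of record (`texpAOfRecordFrom_succ`). [cite: Balaban1988Convergent, (2.18) p.257, (3.24)–(3.25) p.270; Balaban1989LargeFieldI, (0.3)–(0.4) p.176] -/
theorem sum_fiber_classWeightOfDatum₉_succ_eq (ϑ : Stage9Params F N) (D : FiniteEpsData F (SU N)) (g₀ : ℕ → ℝ) (os : List (ULoop F))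
    (p : B12.RunParams) (g : ℕ → ℝ) (m : ℕ) (hm : m < p.K) (t : ℝ) (π : SeqOfRecord F ϑ.ν ϑ.τ9.M g p.K m)
    -- unity of the step weights of record between the front factors of levels `m`, `m + 1`
    (hunit : IsStepUnity (avOfRecord F N p.K m).avg (chiSeqOfRecord F N ϑ.ν ϑ.τ9.M g p.K m)
      (chiSeqOfRecord F N ϑ.ν ϑ.τ9.M g p.K (m + 1)) (wOfRecord₉ F N ϑ p g m))
    -- 𝐓-side provisos
    (hT : Integrable (fun U => chiSeqOfRecord F N ϑ.ν ϑ.τ9.M g p.K m π U * dressedSlotsOfDatum₉ F N ϑ D g₀ os t p g m π U)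
      (fieldMeasure (F.P p.K) m (SU N)))
    (hw : ∀ s', Measurable
      (fun z : GaugeField (F.P p.K) (m + 1) (SU N) × GaugeField (F.P p.K) m (SU N) => wOfRecord₉ F N ϑ p g m s' z.2 z.1))
    (hwb : ∀ s' U V', |wOfRecord₉ F N ϑ p g m s' U V'| ≤ 1)
    (hχ : ∀ s', Measurable (chiSeqOfRecord F N ϑ.ν ϑ.τ9.M g p.K (m + 1) s'))
    -- 𝐑-side provisos on the PRE-𝐑 dressed family at level `m + 1`
    (hm' : ∀ s', Measurable (fun V => chiSeqOfRecord F N ϑ.ν ϑ.τ9.M g p.K (m + 1) s' V *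
      tstepOfRecord F N ϑ.ν ϑ.τ9.M (wOfRecord₉ F N ϑ) p g m (dressedSlotsOfDatum₉ F N ϑ D g₀ os t p g m) s' V))
    (h0' : ∀ s' V, 0 ≤ chiSeqOfRecord F N ϑ.ν ϑ.τ9.M g p.K (m + 1) s' V *
      tstepOfRecord F N ϑ.ν ϑ.τ9.M (wOfRecord₉ F N ϑ) p g m (dressedSlotsOfDatum₉ F N ϑ D g₀ os t p g m) s' V) {C : ℝ}
    (hC' : ∀ s' V, chiSeqOfRecord F N ϑ.ν ϑ.τ9.M g p.K (m + 1) s' V *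
      tstepOfRecord F N ϑ.ν ϑ.τ9.M (wOfRecord₉ F N ϑ) p g m (dressedSlotsOfDatum₉ F N ϑ D g₀ os t p g m) s' V ≤ C)
    (hden' : ∀ s' V, fibreIntegral (fibOfSeq F ϑ.ν ϑ.τ9 p g (m + 1) s')
      (fun V => chiSeqOfRecord F N ϑ.ν ϑ.τ9.M g p.K (m + 1) (ϑ.ppSel p g (m + 1) s') V *
        tstepOfRecord F N ϑ.ν ϑ.τ9.M (wOfRecord₉ F N ϑ) p g m (dressedSlotsOfDatum₉ F N ϑ D g₀ os t p g m) (ϑ.ppSel p g (m + 1) s') V) V ≠ 0)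
    -- the pin: the selector preserves the prefix of every massive pre-𝐑 sequence
    (hsel : ∀ s', (ϑ.ppSel p g (m + 1) s').init = s'.init ∨
      ∫ V, chiSeqOfRecord F N ϑ.ν ϑ.τ9.M g p.K (m + 1) s' V *
        tstepOfRecord F N ϑ.ν ϑ.τ9.M (wOfRecord₉ F N ϑ) p g m (dressedSlotsOfDatum₉ F N ϑ D g₀ os t p g m) s' V
          ∂(fieldMeasure (F.P p.K) (m + 1) (SU N)) = 0) :
    ∑ s' ∈ Finset.univ.filter (fun s' : SeqOfRecord F ϑ.ν ϑ.τ9.M g p.K (m + 1) => s'.init = π),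
        classWeightOfDatum₉ F N ϑ D g₀ os p g (m + 1) t s' = classWeightOfDatum₉ F N ϑ D g₀ os p g m t π := by
  -- the slot recursion of record: `slot_{m+1} = 𝐑_{m+1}(𝐓-step slot_m)` (`texpAOfRecordFrom_succ`), `𝐑` of record as the slot operation at `ϑ.ppSel p g (m+1)`
  have hrec : dressedSlotsOfDatum₉ F N ϑ D g₀ os t p g (m + 1) =
      rstepSlotOfRecord F N ϑ.ν ϑ.τ9 ϑ.ppSel p g (m + 1)
        (tstepOfRecord F N ϑ.ν ϑ.τ9.M (wOfRecord₉ F N ϑ) p g m (dressedSlotsOfDatum₉ F N ϑ D g₀ os t p g m)) :=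
    texpAOfRecordFrom_succ F N ϑ.ν ϑ.τ9.M _ (wOfRecord₉ F N ϑ) (rstepSlotOfRecord F N ϑ.ν ϑ.τ9 ϑ.ppSel) p g m
  have hR : rstepSlotOfRecord F N ϑ.ν ϑ.τ9 ϑ.ppSel p g (m + 1) = rstepSlot F N ϑ.ν ϑ.τ9 p g (m + 1) (ϑ.ppSel p g (m + 1)) := rfl
  unfold classWeightOfDatum₉
  rw [hrec, hR]
  -- the 𝐑-half (def-R's slot operation reads the bond-decidability instance of its own definition: the denominator proviso is handed over by `convert`,
  -- the two `DecidableEq (PBond …)` instances being equal as inhabitants of a subsingleton), then the 𝐓-half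
  refine (sum_filter_integral_chi_mul_rstepSlot F N ϑ.ν ϑ.τ9 p g m (ϑ.ppSel p g (m + 1)) _ hm' h0' hC' (fun s' V => ?_) hsel π).trans
    (sum_fiber_integral_chi_tstepOfRecord F N ϑ.ν ϑ.τ9.M (wOfRecord₉ F N ϑ) p g m hm _ π hT hw hwb hχ hunit)
  convert hden' s' V using 3

end Literature.MathematicalPhysics.QuantumFieldTheory.Balaban1983to89.Node00

end
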